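import Summits.ValiantsHypothesis.ValiantsHypothesis.Theorems.BarrierLeverChowStarveCertificate
import Summits.ValiantsHypothesis.ValiantsHypothesis.Theorems.BarrierLeverChowStarveKernel

/-!
# Route BarrierLever — item 20195 `ChowHitsThinRowPartitionMinors` is FALSE, VI: dead layouts for
# every product of affine forms with constant term `1`

Helper file (`--supports stmt-ValiantsHypothesis-20195`; cell valiant-natproofs, rung V4, 𝒟-side;
seat val-np-p2 gen 9).  Closes NO item; definition-free.  Assembles `…ChowStarveCertificate`
(row-dependence certificate for each admissible column) and `…ChowStarveKernel` (existence of the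
certificate matrix) into:

* `det_thinLayout_eq_zero_of_constOne` — let the rows `u i` be distinct and contain EVERY set of
  size `≤ 2`, and let every column `w j` have `|w j| ≤ 3`, no two distinct elements in the starved
  block `O = {e : o < e}`, and lie outside `O` entirely when `|w j| = 3`.  If `h + 2h < C(o+1, 2)` then
  for ALL coefficient tables `A, B` with `det (Σ_k A k a · B k c)_{a,c} ≠ 0` the partition minor of
  `∏_k (1 + Σ_a A k a x_a + Σ_c B k c y_c)` on `(u, w)` VANISHES (a nonzero vector in the left
  kernel: `Matrix.exists_vecMul_eq_zero_iff`).

WHAT THIS IS NOT: the removal of the two genericity assumptions (constant terms `1`, `det ≠ 0`) is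
the polynomial-identity argument of the sequel file; nothing on item 19717, on crux
stmt-ValiantsHypothesis-14610, or on `VP` versus `VNP`.
-/

set_option linter.dupNamespace false

namespace Summit.ValiantsHypothesis.ValiantsHypothesis.Theorems.BarrierLever.ChowStarve

open Finset MvPolynomial

variable {h : ℕ}

/-- Selecting one row: if `u` is injective and `u i₀ = S`, then
`Σ_i [u i = S] · c · g (u i) = c · g S`. -/
theorem sum_ite_row_eq {r : ℕ} (u : Fin r → Finset (Fin h)) (hu : Function.Injective u)
    (S : Finset (Fin h)) (i₀ : Fin r) (hi₀ : u i₀ = S) (c : ℂ) (g : Finset (Fin h) → ℂ) :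
    ∑ i, (if u i = S then c else 0) * g (u i) = c * g S := by
  rw [Finset.sum_eq_single i₀]
  · rw [if_pos hi₀, hi₀]
  · intro i _ hi
    rw [if_neg (fun e => hi (hu (e.trans hi₀.symm))), zero_mul]
  · intro hi
    exact absurd (Finset.mem_univ i₀) hi

/-- **Dead layouts for products with constant term `1`.** -/
theorem det_thinLayout_eq_zero_of_constOne (o : ℕ) {r : ℕ} (u w : Fin r → Finset (Fin h))
    (hu : Function.Injective u) (hcov : ∀ U : Finset (Fin h), U.card ≤ 2 → ∃ i, u i = U)
    (hw3 : ∀ j, (w j).card ≤ 3)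
    (hwO : ∀ j, ∀ c ∈ w j, ∀ c' ∈ w j, c ≠ c' → (c : ℕ) ≤ o ∨ (c' : ℕ) ≤ o)
    (hwK : ∀ j, (w j).card = 3 → ∀ e ∈ w j, (e : ℕ) ≤ o)
    (hoh : o + o < h) (hcount : h + (h + h) < Nat.choose (o + 1) 2)
    (A B : Fin (h + h) → Fin h → ℂ)
    (hdet : (Matrix.of fun a c : Fin h => ∑ k, A k a * B k c).det ≠ 0) :
    (Matrix.of fun i j : Fin r => coeff (∑ a ∈ u i, Finsupp.single (Fin.castAdd h a) 1 + ∑ c ∈ w j, Finsupp.single (Fin.natAdd h c) 1) (∏ k, ((C 1 + ∑ a, C (A k a) * X (Fin.castAdd h a) + ∑ c, C (B k c) * X (Fin.natAdd h c)) : MvPolynomial (Fin (h + h)) ℂ))).det = 0 := by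
  classical
  -- the starved block as an injection `ω : Fin o → Fin h`, `ω i = o + 1 + i`
  let ω : Fin o → Fin h := fun i => ⟨o + 1 + i, by omega⟩
  have hω : Function.Injective ω := by
    intro i j e
    have := congrArg Fin.val e
    simp only [ω] at this
    exact Fin.ext (by omega)
  have hrange : ∀ e : Fin h, (e : ℕ) ≤ o → e ∉ Set.range ω := by
    rintro e he ⟨i, rfl⟩
    simp only [ω] at he
    omega
  -- the certificate matrix
  obtain ⟨N, hNsym, hNdiag, hNiso, hNkill, a₀, b₀, hab₀, hN₀⟩ :=
    exists_certificate_matrix o ω hω A (Matrix.of fun a c : Fin h => ∑ k, A k a * B k c) hdet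
      (by rw [Fintype.card_fin]; exact hcount)
  have hkill : ∀ e : Fin h, (e : ℕ) ≤ o → ∀ a, ∑ b, N a b * (∑ k, A k b * B k e) = 0 := by
    intro e he a
    have := hNkill e (hrange e he) a
    simpa only [Matrix.of_apply] using this
  -- every column is annihilated
  have hcol : ∀ j, (∑ k : Fin (h + h), ∑ k' : Fin (h + h), (∑ a, ∑ b, A k a * N a b * A k' b)) / 2 *
        coeff (∑ a ∈ (∅ : Finset (Fin h)), Finsupp.single (Fin.castAdd h a) 1 + ∑ c ∈ w j, Finsupp.single (Fin.natAdd h c) 1) (∏ k, ((C 1 + ∑ a, C (A k a) * X (Fin.castAdd h a) + ∑ c, C (B k c) * X (Fin.natAdd h c)) : MvPolynomial (Fin (h + h)) ℂ)) +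
      ∑ a, (-(∑ b, N a b * ∑ j', A j' b)) * coeff (∑ a' ∈ ({a} : Finset (Fin h)), Finsupp.single (Fin.castAdd h a') 1 + ∑ c ∈ w j, Finsupp.single (Fin.natAdd h c) 1) (∏ k, ((C 1 + ∑ a, C (A k a) * X (Fin.castAdd h a) + ∑ c, C (B k c) * X (Fin.natAdd h c)) : MvPolynomial (Fin (h + h)) ℂ)) +
      ∑ a, ∑ b ∈ Finset.univ.erase a, N a b / 2 * coeff (∑ a' ∈ ({a, b} : Finset (Fin h)), Finsupp.single (Fin.castAdd h a') 1 + ∑ c ∈ w j, Finsupp.single (Fin.natAdd h c) 1) (∏ k, ((C 1 + ∑ a, C (A k a) * X (Fin.castAdd h a) + ∑ c, C (B k c) * X (Fin.natAdd h c)) : MvPolynomial (Fin (h + h)) ℂ)) = 0 := by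
    intro j
    refine thinRows_certificate A B N hNsym hNdiag hNiso (w j) (hw3 j) ?_ ?_
    · intro c hc c' hc' hne
      rcases hwO j c hc c' hc' hne with hcK | hc'K
      · exact sum_N_mul_eq_zero_left N hNsym _ _ (hkill c hcK)
      · exact sum_N_mul_eq_zero_right N _ _ (hkill c' hc'K)
    · intro h3 e he a
      exact hkill e (hwK j h3 e he) a
  -- the row vector
  let Φ : Finset (Fin h) → ℂ := fun U =>
    (if U = ∅ then (∑ k : Fin (h + h), ∑ k' : Fin (h + h), (∑ a, ∑ b, A k a * N a b * A k' b)) / 2 else 0) +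
      ∑ a, (if U = {a} then -(∑ b, N a b * ∑ j', A j' b) else 0) +
      ∑ a, ∑ b ∈ Finset.univ.erase a, (if U = {a, b} then N a b / 2 else 0)
  apply Matrix.exists_vecMul_eq_zero_iff.mp
  refine ⟨fun i => Φ (u i), ?_, ?_⟩
  · -- the vector is nonzero at the row `{a₀, b₀}`
    obtain ⟨i₁, hi₁⟩ := hcov {a₀, b₀} (by rw [Finset.card_pair hab₀])
    intro hzero
    have hv := congrFun hzero i₁
    simp only [Pi.zero_apply, hi₁, Φ] at hv
    have hne : ({a₀, b₀} : Finset (Fin h)) ≠ ∅ := Finset.insert_ne_empty a₀ _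
    have hns : ∀ a : Fin h, ({a₀, b₀} : Finset (Fin h)) ≠ {a} := by
      intro a e
      have := Finset.card_pair hab₀
      rw [e, Finset.card_singleton] at this
      omega
    simp only [hne, if_false, hns, Finset.sum_const_zero, zero_add] at hv
    -- the pair part equals `N a₀ b₀`
    have hpair : ∑ a, ∑ b ∈ Finset.univ.erase a,
        (if ({a₀, b₀} : Finset (Fin h)) = {a, b} then N a b / 2 else 0) = N a₀ b₀ := by
      have hmem : ∀ a b : Fin h, ({a₀, b₀} : Finset (Fin h)) = {a, b} → a = a₀ ∨ a = b₀ := by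
        intro a b e
        have ha : a ∈ ({a₀, b₀} : Finset (Fin h)) := by rw [e]; exact Finset.mem_insert_self a _
        simpa [Finset.mem_insert, Finset.mem_singleton] using ha
      rw [Finset.sum_eq_add a₀ b₀ hab₀]
      · -- the two surviving outer terms
        have e1 : ∑ b ∈ Finset.univ.erase a₀,
            (if ({a₀, b₀} : Finset (Fin h)) = {a₀, b} then N a₀ b / 2 else 0) = N a₀ b₀ / 2 := by
          rw [Finset.sum_eq_single b₀]
          · rw [if_pos rfl]
          · intro b hb hbne
            rw [if_neg]
            intro e
            have hb' : b ∈ ({a₀, b₀} : Finset (Fin h)) := by rw [e]; simp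
            rcases Finset.mem_insert.mp hb' with hb1 | hb1
            · exact (Finset.ne_of_mem_erase hb) hb1
            · exact hbne (Finset.mem_singleton.mp hb1)
          · intro hb
            exact absurd (Finset.mem_erase.mpr ⟨hab₀.symm, Finset.mem_univ _⟩) hb
        have e2 : ∑ b ∈ Finset.univ.erase b₀,
            (if ({a₀, b₀} : Finset (Fin h)) = {b₀, b} then N b₀ b / 2 else 0) = N b₀ a₀ / 2 := by
          rw [Finset.sum_eq_single a₀]
          · rw [if_pos (Finset.pair_comm a₀ b₀)]
          · intro b hb hbne
            rw [if_neg]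
            intro e
            have hb' : b ∈ ({a₀, b₀} : Finset (Fin h)) := by rw [e]; simp
            rcases Finset.mem_insert.mp hb' with hb1 | hb1
            · exact hbne hb1
            · exact (Finset.ne_of_mem_erase hb) (Finset.mem_singleton.mp hb1)
          · intro hb
            exact absurd (Finset.mem_erase.mpr ⟨hab₀, Finset.mem_univ _⟩) hb
        rw [e1, e2, hNsym b₀ a₀]
        ring
      · intro a _ ha
        refine Finset.sum_eq_zero fun b _ => ?_
        rw [if_neg]
        intro e
        rcases hmem a b e with e' | e'
        · exact ha.1 e'
        · exact ha.2 e'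
      · intro ha; exact absurd (Finset.mem_univ a₀) ha
      · intro hb; exact absurd (Finset.mem_univ b₀) hb
    rw [hpair] at hv
    exact hN₀ hv
  · -- the vector annihilates every column
    funext j
    rw [Matrix.vecMul, Pi.zero_apply]
    change ∑ i, Φ (u i) * (Matrix.of fun i j : Fin r => coeff (∑ a ∈ u i, Finsupp.single (Fin.castAdd h a) 1 + ∑ c ∈ w j, Finsupp.single (Fin.natAdd h c) 1) (∏ k, ((C 1 + ∑ a, C (A k a) * X (Fin.castAdd h a) + ∑ c, C (B k c) * X (Fin.natAdd h c)) : MvPolynomial (Fin (h + h)) ℂ))) i j = 0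
    simp only [Matrix.of_apply]
    have hsplit : ∀ i, Φ (u i) * coeff (∑ a ∈ u i, Finsupp.single (Fin.castAdd h a) 1 + ∑ c ∈ w j, Finsupp.single (Fin.natAdd h c) 1) (∏ k, ((C 1 + ∑ a, C (A k a) * X (Fin.castAdd h a) + ∑ c, C (B k c) * X (Fin.natAdd h c)) : MvPolynomial (Fin (h + h)) ℂ)) =
        (if u i = ∅ then (∑ k : Fin (h + h), ∑ k' : Fin (h + h), (∑ a, ∑ b, A k a * N a b * A k' b)) / 2 else 0) *
            coeff (∑ a ∈ u i, Finsupp.single (Fin.castAdd h a) 1 + ∑ c ∈ w j, Finsupp.single (Fin.natAdd h c) 1) (∏ k, ((C 1 + ∑ a, C (A k a) * X (Fin.castAdd h a) + ∑ c, C (B k c) * X (Fin.natAdd h c)) : MvPolynomial (Fin (h + h)) ℂ)) +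
          ∑ a, (if u i = {a} then -(∑ b, N a b * ∑ j', A j' b) else 0) *
            coeff (∑ a ∈ u i, Finsupp.single (Fin.castAdd h a) 1 + ∑ c ∈ w j, Finsupp.single (Fin.natAdd h c) 1) (∏ k, ((C 1 + ∑ a, C (A k a) * X (Fin.castAdd h a) + ∑ c, C (B k c) * X (Fin.natAdd h c)) : MvPolynomial (Fin (h + h)) ℂ)) +
          ∑ a, ∑ b ∈ Finset.univ.erase a, (if u i = {a, b} then N a b / 2 else 0) *
            coeff (∑ a ∈ u i, Finsupp.single (Fin.castAdd h a) 1 + ∑ c ∈ w j, Finsupp.single (Fin.natAdd h c) 1) (∏ k, ((C 1 + ∑ a, C (A k a) * X (Fin.castAdd h a) + ∑ c, C (B k c) * X (Fin.natAdd h c)) : MvPolynomial (Fin (h + h)) ℂ)) := by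
      intro i
      simp only [Φ, add_mul, Finset.sum_mul]
    rw [Finset.sum_congr rfl fun i _ => hsplit i, Finset.sum_add_distrib, Finset.sum_add_distrib]
    -- row `∅`
    obtain ⟨i0, hi0⟩ := hcov ∅ (by simp)
    rw [sum_ite_row_eq u hu ∅ i0 hi0 _ (fun U => coeff (∑ a ∈ U, Finsupp.single (Fin.castAdd h a) 1 + ∑ c ∈ w j, Finsupp.single (Fin.natAdd h c) 1) (∏ k, ((C 1 + ∑ a, C (A k a) * X (Fin.castAdd h a) + ∑ c, C (B k c) * X (Fin.natAdd h c)) : MvPolynomial (Fin (h + h)) ℂ)))]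
    -- rows `{a}`
    have hc1 : ∑ i, ∑ a, (if u i = {a} then -(∑ b, N a b * ∑ j', A j' b) else 0) *
            coeff (∑ a ∈ u i, Finsupp.single (Fin.castAdd h a) 1 + ∑ c ∈ w j, Finsupp.single (Fin.natAdd h c) 1) (∏ k, ((C 1 + ∑ a, C (A k a) * X (Fin.castAdd h a) + ∑ c, C (B k c) * X (Fin.natAdd h c)) : MvPolynomial (Fin (h + h)) ℂ)) =
        ∑ a, ∑ i, (if u i = {a} then -(∑ b, N a b * ∑ j', A j' b) else 0) *
            coeff (∑ a ∈ u i, Finsupp.single (Fin.castAdd h a) 1 + ∑ c ∈ w j, Finsupp.single (Fin.natAdd h c) 1) (∏ k, ((C 1 + ∑ a, C (A k a) * X (Fin.castAdd h a) + ∑ c, C (B k c) * X (Fin.natAdd h c)) : MvPolynomial (Fin (h + h)) ℂ)) := Finset.sum_comm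
    rw [hc1]
    have hrow1 : ∀ a : Fin h, ∑ i, (if u i = {a} then -(∑ b, N a b * ∑ j', A j' b) else 0) *
        coeff (∑ a ∈ u i, Finsupp.single (Fin.castAdd h a) 1 + ∑ c ∈ w j, Finsupp.single (Fin.natAdd h c) 1) (∏ k, ((C 1 + ∑ a, C (A k a) * X (Fin.castAdd h a) + ∑ c, C (B k c) * X (Fin.natAdd h c)) : MvPolynomial (Fin (h + h)) ℂ)) =
        -(∑ b, N a b * ∑ j', A j' b) * coeff (∑ a' ∈ ({a} : Finset (Fin h)), Finsupp.single (Fin.castAdd h a') 1 + ∑ c ∈ w j, Finsupp.single (Fin.natAdd h c) 1) (∏ k, ((C 1 + ∑ a, C (A k a) * X (Fin.castAdd h a) + ∑ c, C (B k c) * X (Fin.natAdd h c)) : MvPolynomial (Fin (h + h)) ℂ)) := by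
      intro a
      obtain ⟨ia, hia⟩ := hcov {a} (by simp)
      exact sum_ite_row_eq u hu {a} ia hia _ (fun U => coeff (∑ a ∈ U, Finsupp.single (Fin.castAdd h a) 1 + ∑ c ∈ w j, Finsupp.single (Fin.natAdd h c) 1) (∏ k, ((C 1 + ∑ a, C (A k a) * X (Fin.castAdd h a) + ∑ c, C (B k c) * X (Fin.natAdd h c)) : MvPolynomial (Fin (h + h)) ℂ)))
    simp_rw [hrow1]
    -- rows `{a, b}`
    have hc2 : ∑ i, ∑ a, ∑ b ∈ Finset.univ.erase a, (if u i = {a, b} then N a b / 2 else 0) *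
            coeff (∑ a ∈ u i, Finsupp.single (Fin.castAdd h a) 1 + ∑ c ∈ w j, Finsupp.single (Fin.natAdd h c) 1) (∏ k, ((C 1 + ∑ a, C (A k a) * X (Fin.castAdd h a) + ∑ c, C (B k c) * X (Fin.natAdd h c)) : MvPolynomial (Fin (h + h)) ℂ)) =
        ∑ a, ∑ i, ∑ b ∈ Finset.univ.erase a, (if u i = {a, b} then N a b / 2 else 0) *
            coeff (∑ a ∈ u i, Finsupp.single (Fin.castAdd h a) 1 + ∑ c ∈ w j, Finsupp.single (Fin.natAdd h c) 1) (∏ k, ((C 1 + ∑ a, C (A k a) * X (Fin.castAdd h a) + ∑ c, C (B k c) * X (Fin.natAdd h c)) : MvPolynomial (Fin (h + h)) ℂ)) := Finset.sum_comm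
    rw [hc2]
    have hrow2 : ∀ a : Fin h, ∑ i, ∑ b ∈ Finset.univ.erase a,
        (if u i = {a, b} then N a b / 2 else 0) * coeff (∑ a ∈ u i, Finsupp.single (Fin.castAdd h a) 1 + ∑ c ∈ w j, Finsupp.single (Fin.natAdd h c) 1) (∏ k, ((C 1 + ∑ a, C (A k a) * X (Fin.castAdd h a) + ∑ c, C (B k c) * X (Fin.natAdd h c)) : MvPolynomial (Fin (h + h)) ℂ)) =
        ∑ b ∈ Finset.univ.erase a, N a b / 2 * coeff (∑ a' ∈ ({a, b} : Finset (Fin h)), Finsupp.single (Fin.castAdd h a') 1 + ∑ c ∈ w j, Finsupp.single (Fin.natAdd h c) 1) (∏ k, ((C 1 + ∑ a, C (A k a) * X (Fin.castAdd h a) + ∑ c, C (B k c) * X (Fin.natAdd h c)) : MvPolynomial (Fin (h + h)) ℂ)) := by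
      intro a
      rw [Finset.sum_comm]
      refine Finset.sum_congr rfl fun b hb => ?_
      obtain ⟨iab, hiab⟩ := hcov {a, b} (by
        rw [Finset.card_pair (Finset.ne_of_mem_erase hb).symm])
      exact sum_ite_row_eq u hu {a, b} iab hiab _ (fun U => coeff (∑ a ∈ U, Finsupp.single (Fin.castAdd h a) 1 + ∑ c ∈ w j, Finsupp.single (Fin.natAdd h c) 1) (∏ k, ((C 1 + ∑ a, C (A k a) * X (Fin.castAdd h a) + ∑ c, C (B k c) * X (Fin.natAdd h c)) : MvPolynomial (Fin (h + h)) ℂ)))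
    simp_rw [hrow2]
    exact hcol j

end Summit.ValiantsHypothesis.ValiantsHypothesis.Theorems.BarrierLever.ChowStarve
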